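import Literature.AlgebraicGeometry.Motives.FaltingsECSubspacesProofs
import HarnessLib

/-!
# Faltings 1983, Satz 4 for an elliptic curve: the assembly keyed to its two remaining inputs,
# and Satz 4 as the non-abelianness of the `ℓ`-adic image

Theorem-only `Proofs` companion of `Literature.AlgebraicGeometry.Motives.FaltingsEC`, serving the
named fact `Literature.AlgebraicGeometry.Motives.mem_span_range_tateEndRingHom_iff W ℓ` —
G. Faltings, *Endlichkeitssätze für abelsche Varietäten über Zahlkörpern*, Invent. Math. 73
(1983), §5 Satz 4 for `A = E` an elliptic curve over a number field `K` and a prime `ℓ`: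
`End_K(E) ⊗_ℤ ℤ_ℓ → End_π(T_ℓ E)`, `π = Gal(K̄/K)`, is an isomorphism (Engl. transl.:
Cornell–Silverman (eds.), *Arithmetic Geometry* (1986), Ch. II, §5 Theorem 4, "the natural maps
`End_K(A) ⊗_ℤ ℤ_ℓ → End_π(T_ℓ(A))` … are isomorphisms"; held copy
`book:cornellnd-arithmetic-geometry`, PDF pp. 89–90); in the tree's form: a `ℤ_ℓ`-linear
endomorphism of `T_ℓ E` lies in `ℤ_ℓ · End_K(E)` iff it commutes with `Γ_K`.

## What this file records

`FaltingsECEndCoreProofs` reduces the fact, by linear algebra in the plane `V_ℓ E`, to the inputs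
of the printed proof for `g = 1` that the tree states as named facts, ending with
`mem_span_range_tateEndRingHom_iff_of_siegel_of_neronOggShafarevich_of_core` (four hypotheses:
Siegel's theorem *AEC* Cor. IX.3.2.1, the criterion of Néron–Ogg–Shafarevich *AEC* Thm. VII.7.1,
the separable quotient isogeny *AEC* Prop. III.4.12, and the residual core
`exists_eq_smul_one_of_equivariant_of_not_hasRationalCM W ℓ` of `FaltingsECEndCore`). Two of
these are now **theorems** of the tree:

* *AEC* Prop. III.4.12 — `WeierstrassCurve.exists_separable_isogeny_ker_eq_holds` and the
  quotient-with-dual package `WeierstrassCurve.exists_isogeny_ker_eq_and_comp_eq_nsmul_holds`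
  (`Literature.NumberTheory.EllipticCurves.IsogenyQuotientCurveProofs`);
* *AEC* Thm. VII.7.1 and Cor. VII.7.2 — `WeierstrassCurve.neronOggShafarevich_holds`,
  `WeierstrassCurve.IsIsogenous.badPlaces_eq_holds`, whence *AEC* Cor. IX.6.2
  (`WeierstrassCurve.finite_isogenyClass W`) from Shafarevich's Thm. IX.6.1 alone
  (`WeierstrassCurve.finite_isogenyClass_of_shafarevich`) and from Siegel's theorem alone
  (`WeierstrassCurve.finite_isogenyClass_of_siegel`, file `IsogenyClassFiniteProofs`).

Accordingly Satz 4 for `E` is keyed here to exactly **two** named facts — Shafarevich's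
finiteness of the `K`-isogeny class in any of its three forms (`WeierstrassCurve.finite_isogenyClass W`
*AEC* Cor. IX.6.2 / `WeierstrassCurve.shafarevich_finite_goodReductionOutside K` Thm. IX.6.1 /
`WeierstrassCurve.siegel_finite_integralPoints K` Cor. IX.3.2.1) and the core fact — and the
discharge `mem_span_range_tateEndRingHom_iff_holds` will be the one-line
`mem_span_range_tateEndRingHom_iff_of_siegel_of_core W ℓ (siegel…_holds K) (core…_holds W ℓ)`
(status 2026-08-15: both inputs are undischarged named facts; neither Siegel's theorem nor the
non-abelianness of the `ℓ`-adic image of a non-CM curve is in Mathlib or the tree).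

Secondly the file puts the residual in the form in which the literature proves it. Granted
Cor. IX.6.2, Satz 4 for `E` is *equivalent* to each of:
(i) the core fact (`mem_span_range_tateEndRingHom_iff_iff_core_of_isogenyClass`);
(ii) **for every `E` with `End_K(E) = ℤ` the image of `Γ_K` in `GL(V_ℓ E)` is not abelian**
(`mem_span_range_tateEndRingHom_iff_iff_exists_mul_ne_mul_of_isogenyClass`) — J.-P. Serre,
*Abelian ℓ-adic representations and elliptic curves* (1968), Ch. IV, §2.2, Théorème: for a curve
without complex multiplication `g_ℓ = Lie(ρ_ℓ(Γ_K)) = End(V_ℓ)`, in particular the image is not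
abelian (proved there through the local algebraicity of abelian rational semisimple `ℓ`-adic
representations, Ch. III, i.e. Tate's Hodge–Tate decomposition); Faltings obtains it from
Sätze 1–2 through the abelian surfaces `(E × E)/G_n`. The implication "Satz 4 ⇒ non-abelian
image for `End_K(E) = ℤ`" holds unconditionally (`exists_mul_ne_mul_of_faltings`): were all
`ρ(σ)` to commute, a non-scalar `ρ(σ₀)` — or, if every `ρ(σ)` is a scalar, any non-scalar
endomorphism — would be an equivariant endomorphism outside `ℚ_ℓ = End_K(E) ⊗ ℚ_ℓ`.

## Contents (all proved; no definitions, no new named facts)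

* `exists_ne_smul_one_of_finrank_eq_two`: a plane has a non-scalar endomorphism (linear algebra).
* `exists_mul_ne_mul_of_faltings`: Satz 4 for `E` and `End_K(E) = ℤ` give non-commuting
  `ρ(σ), ρ(τ)` on `V_ℓ E`.
* `mem_span_range_tateEndRingHom_iff_of_isogenyClass_of_core`, `…_of_shafarevich_of_core`,
  `…_of_siegel_of_core`: Satz 4 for `E` from Cor. IX.6.2 / Thm. IX.6.1 / Cor. IX.3.2.1 and the
  core fact.
* `mem_span_range_tateEndRingHom_iff_of_hasRationalCM_of_isogenyClass`, `…_of_hasRationalCM_of_siegel`: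
  for a curve with `K`-rational complex multiplication no core is needed.
* `mem_span_range_tateEndRingHom_iff_iff_core_of_isogenyClass`, `…_iff_core_of_siegel`:
  granted Cor. IX.6.2 (resp. Siegel's theorem), Satz 4 for `E` ⟺ the core fact.
* `core_of_forall_exists_mul_ne_mul`, `mem_span_range_tateEndRingHom_iff_of_isogenyClass_of_exists_mul_ne_mul`,
  `mem_span_range_tateEndRingHom_iff_iff_exists_mul_ne_mul_of_isogenyClass`, `…_of_siegel`:
  Satz 4 for `E` ⟺ non-abelian `ℓ`-adic image of the curves with `End_K(E) = ℤ`.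
* `finrank_ne_one_of_stable_of_not_hasRationalCM_of_isogenyClass`, `…_of_siegel`: for
  `End_K(E) = ℤ`, Cor. IX.6.2 (resp. Siegel's theorem) alone makes `V_ℓ E` irreducible
  (Serre 1968, IV.2.1) — the irreducibility hypothesis of the core fact is free.
* `mem_span_range_tateModule_map_of_equivariant_self_of_isogenyClass_of_core`, `…_self_of_siegel_of_core`:
  Faltings' Korollar 1 for the pair `(E, E)` from the same two inputs.

## References

* [Faltings1983Endlichkeit] G. Faltings, *Endlichkeitssätze für abelsche Varietäten über
  Zahlkörpern*, Invent. Math. 73 (1983), 349–366, §5 Satz 4 and Korollar 1, with the proof of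
  Sätze 3–4; Engl. transl. [Faltings1986FinitenessTranslation] in G. Cornell, J. H. Silverman
  (eds.), *Arithmetic Geometry*, Springer 1986, Ch. II §5, Theorems 3–4, Corollary 1 (held copy
  `book:cornellnd-arithmetic-geometry`, PDF pp. 89–90; read).
* [Serre1968] J.-P. Serre, *Abelian ℓ-adic representations and elliptic curves*, Benjamin
  1968, Ch. IV, §2.1 (irreducibility through Šafarevič's theorem) and §2.2 (the Lie algebra of
  `ρ_ℓ` for a curve without complex multiplication); not held, cited from the standard account.
* [SilvermanAEC2009] J. H. Silverman, *The Arithmetic of Elliptic Curves*, 2nd ed., GTM 106: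
  Thm. III.7.4, Prop. III.4.12, Thm. VII.7.1, Cor. VII.7.2, Cor. IX.3.2.1, Thm. IX.6.1, Cor. IX.6.2.

## Design

Theorems only; `noncomputable section`; one universe `u`; base field `K : Type u` with the
instance hypotheses `[NumberField K] [W.IsElliptic]` quantified inside the named facts, as in
`FaltingsEC`; hypothesis names (`hS`, `hSha`, `hSiegel`, `hcore`, `hCM`) as in
`FaltingsECEndCoreProofs` and `FaltingsECSubspacesProofs`, with which the file composes. The file
imports `FaltingsECSubspacesProofs` (hence `FaltingsECEndCoreProofs`, `IsogenyQuotientCurveProofs`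
and `IsogenyClassFiniteProofs`) and nothing from the abelian-variety side of the tree.
-/

noncomputable section

universe u

namespace Literature.AlgebraicGeometry.Motives

open WeierstrassCurve Module

/-! ## Linear algebra: a plane has a non-scalar endomorphism -/

section TwoDim

variable {F V : Type*} [Field F] [AddCommGroup V] [Module F V]

/-- A two-dimensional vector space carries an endomorphism which is not a scalar: the projection
onto a line along a complement has a line as image (`exists_three_lines`,
`not_exists_eq_smul_one_of_finrank_range_eq_one`). [folklore] -/
theorem exists_ne_smul_one_of_finrank_eq_two (h2 : finrank F V = 2) :
    ∃ a : Module.End F V, ¬ ∃ c : F, a = c • 1 := by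
  obtain ⟨L, -, -, hL, -⟩ := exists_three_lines h2
  obtain ⟨M, hLM⟩ := L.exists_isCompl
  refine ⟨L.subtype ∘ₗ L.projectionOnto M hLM,
    not_exists_eq_smul_one_of_finrank_range_eq_one h2 ?_⟩
  rw [LinearMap.range_comp_of_range_eq_top _ (Submodule.range_projectionOnto hLM),
    Submodule.range_subtype, hL]

end TwoDim

/-! ## Satz 4 for `E` forces a non-abelian `ℓ`-adic image when `End_K(E) = ℤ` -/

variable {K : Type u} [Field K] (W : WeierstrassCurve K) (ℓ : ℕ) [Fact ℓ.Prime]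

/-- **Satz 4 for `E` makes the `ℓ`-adic image non-abelian when `End_K(E) = ℤ`** (no finiteness
theorem needed). Granted `mem_span_range_tateEndRingHom_iff W ℓ` (Faltings 1983, §5 Satz 4 for
`E`), if `E` is elliptic over a number field `K` without `K`-rational complex multiplication,
there are `σ, τ ∈ Γ_K` whose actions on `V_ℓ E` do not commute. For if all `ρ(σ)` commute, then
either some `ρ(σ₀)` is not a scalar — and `ρ(σ₀)` is a `Γ_K`-equivariant endomorphism — or every
`ρ(σ)` is a scalar — and every endomorphism of the plane `V_ℓ E` is equivariant, in particular a
non-scalar one (`exists_ne_smul_one_of_finrank_eq_two`); either way Satz 4 `⊗ ℚ_ℓ`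
(`mem_rationalEndSpan_of_equivariant`) puts a non-scalar endomorphism in
`E_ℓ = image(End_K(E) ⊗ ℚ_ℓ) = ℚ_ℓ`
(`exists_eq_smul_one_of_mem_rationalEndSpan_of_not_hasRationalCM`), a contradiction. For
curves without complex multiplication the conclusion is contained in Serre 1968, Ch. IV, 2.2
(`Lie ρ_ℓ(Γ_K) = End(V_ℓ E)`); here it is read off Faltings' theorem for every curve with
`End_K(E) = ℤ`. [cite: Faltings1983Endlichkeit, §5 Satz 4] -/
theorem exists_mul_ne_mul_of_faltings (h4 : mem_span_range_tateEndRingHom_iff W ℓ)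
    [NumberField K] [W.IsElliptic] (hCM : ¬ W.HasRationalCM) :
    ∃ σ τ : Field.absoluteGaloisGroup K,
      rationalGaloisRepTate W ℓ σ * rationalGaloisRepTate W ℓ τ ≠
        rationalGaloisRepTate W ℓ τ * rationalGaloisRepTate W ℓ σ := by
  have hℓK : ((ℓ : ℕ) : K) ≠ 0 := Nat.cast_ne_zero.mpr (Fact.out : ℓ.Prime).ne_zero
  -- every equivariant endomorphism of `V_ℓ E` is a scalar
  have hsc : ∀ G : Module.End ℚ_[ℓ] (W.rationalTateModule ℓ),
      (∀ (σ : Field.absoluteGaloisGroup K) (v : W.rationalTateModule ℓ),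
        G (rationalGaloisRepTate W ℓ σ v) = rationalGaloisRepTate W ℓ σ (G v)) →
      ∃ c : ℚ_[ℓ], G = c • 1 :=
    fun G hG ↦ exists_eq_smul_one_of_mem_rationalEndSpan_of_not_hasRationalCM W ℓ hCM
      (mem_rationalEndSpan_of_equivariant W ℓ h4 hG)
  by_contra hab
  push Not at hab
  by_cases hall : ∀ σ : Field.absoluteGaloisGroup K, ∃ c : ℚ_[ℓ], rationalGaloisRepTate W ℓ σ = c • 1
  · -- every `ρ(σ)` is a scalar: a non-scalar endomorphism is equivariant
    obtain ⟨G, hG⟩ := exists_ne_smul_one_of_finrank_eq_two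
      (finrank_rationalTateModule_eq_two_holds W ℓ hℓK)
    refine hG (hsc G fun σ v ↦ ?_)
    obtain ⟨c, hc⟩ := hall σ
    rw [hc, LinearMap.smul_apply, LinearMap.smul_apply, Module.End.one_apply,
      Module.End.one_apply, map_smul]
  · -- some `ρ(σ₀)` is not a scalar, and it is equivariant since the image is abelian
    push Not at hall
    obtain ⟨σ₀, hσ₀⟩ := hall
    obtain ⟨c, hc⟩ := hsc (rationalGaloisRepTate W ℓ σ₀) fun σ v ↦
      LinearMap.congr_fun (hab σ₀ σ) v
    exact hσ₀ c hc

/-! ## Satz 4 for `E` keyed to Shafarevich's finiteness of the isogeny class and the core fact -/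

/-- **Satz 4 for `E` from *AEC* Cor. IX.6.2 and the core fact.** The named fact
`mem_span_range_tateEndRingHom_iff W ℓ` (Faltings 1983, §5 Satz 4 for `E`) follows from
`WeierstrassCurve.finite_isogenyClass W` (Silverman, *AEC*, Cor. IX.6.2: finitely many
`K`-isomorphism classes in the `K`-isogeny class of `E`) and
`exists_eq_smul_one_of_equivariant_of_not_hasRationalCM W ℓ` (`FaltingsECEndCore`): this is the
tree's `mem_span_range_tateEndRingHom_iff_of_facts_of_core` with its quotient-isogeny input
*AEC* Prop. III.4.12 (with the dual, Thm. III.6.1(a)) discharged by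
`WeierstrassCurve.exists_isogeny_ker_eq_and_comp_eq_nsmul_holds`.
[cite: Faltings1983Endlichkeit, §5 Satz 4 (proof, transl. PDF pp. 89–90)] -/
theorem mem_span_range_tateEndRingHom_iff_of_isogenyClass_of_core (hS : W.finite_isogenyClass)
    (hcore : exists_eq_smul_one_of_equivariant_of_not_hasRationalCM W ℓ) :
    mem_span_range_tateEndRingHom_iff W ℓ :=
  mem_span_range_tateEndRingHom_iff_of_facts_of_core W ℓ hS
    (exists_isogeny_ker_eq_and_comp_eq_nsmul_holds W) hcore

/-- **Satz 4 for `E` from Shafarevich's Thm. IX.6.1 and the core fact.** The named fact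
`mem_span_range_tateEndRingHom_iff W ℓ` follows from Shafarevich's theorem for the number field
`K` (`WeierstrassCurve.shafarevich_finite_goodReductionOutside K`, Silverman, *AEC*, Thm. IX.6.1)
and the core fact, Cor. IX.6.2 being the tree's `WeierstrassCurve.finite_isogenyClass_of_shafarevich`
(with Cor. VII.7.2, `WeierstrassCurve.IsIsogenous.badPlaces_eq_holds`).
[cite: Faltings1983Endlichkeit, §5 Satz 4 (proof, transl. PDF pp. 89–90)] -/
theorem mem_span_range_tateEndRingHom_iff_of_shafarevich_of_core
    (hSha : shafarevich_finite_goodReductionOutside K)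
    (hcore : exists_eq_smul_one_of_equivariant_of_not_hasRationalCM W ℓ) :
    mem_span_range_tateEndRingHom_iff W ℓ :=
  mem_span_range_tateEndRingHom_iff_of_isogenyClass_of_core W ℓ
    (finite_isogenyClass_of_shafarevich W hSha) hcore

/-- **Satz 4 for `E` from Siegel's theorem and the core fact** — the shape of the eventual
discharge. The named fact `mem_span_range_tateEndRingHom_iff W ℓ` follows from Siegel's
finiteness of the `S`-integral points of elliptic curves over `K`
(`WeierstrassCurve.siegel_finite_integralPoints K`, Silverman, *AEC*, Cor. IX.3.2.1) and
`exists_eq_smul_one_of_equivariant_of_not_hasRationalCM W ℓ`, Cor. IX.6.2 being the tree's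
`WeierstrassCurve.finite_isogenyClass_of_siegel` (Thm. IX.6.1 through the Mordell curves
`y² = x³ + D`). The other two inputs of the printed proof for `g = 1` — the criterion of
Néron–Ogg–Shafarevich (VII.7.1) and the separable quotient isogeny (III.4.12) — are theorems of
the tree and no longer appear. [cite: Faltings1983Endlichkeit, §5 Satz 4 (proof, transl. PDF pp. 89–90)] -/
theorem mem_span_range_tateEndRingHom_iff_of_siegel_of_core
    (hSiegel : siegel_finite_integralPoints K)
    (hcore : exists_eq_smul_one_of_equivariant_of_not_hasRationalCM W ℓ) :
    mem_span_range_tateEndRingHom_iff W ℓ :=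
  mem_span_range_tateEndRingHom_iff_of_isogenyClass_of_core W ℓ
    (finite_isogenyClass_of_siegel W hSiegel) hcore

/-- **Satz 4 for a curve with `K`-rational complex multiplication from *AEC* Cor. IX.6.2
alone**: for `W.HasRationalCM` the core fact is vacuous. [cite: Faltings1983Endlichkeit, §5 Satz 4 (proof)] -/
theorem mem_span_range_tateEndRingHom_iff_of_hasRationalCM_of_isogenyClass (hCM : W.HasRationalCM)
    (hS : W.finite_isogenyClass) : mem_span_range_tateEndRingHom_iff W ℓ :=
  mem_span_range_tateEndRingHom_iff_of_isogenyClass_of_core W ℓ hS fun hnCM ↦ absurd hCM hnCM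

/-- **Satz 4 for a curve with `K`-rational complex multiplication from Siegel's theorem alone.**
[cite: Faltings1983Endlichkeit, §5 Satz 4 (proof)] -/
theorem mem_span_range_tateEndRingHom_iff_of_hasRationalCM_of_siegel (hCM : W.HasRationalCM)
    (hSiegel : siegel_finite_integralPoints K) : mem_span_range_tateEndRingHom_iff W ℓ :=
  mem_span_range_tateEndRingHom_iff_of_hasRationalCM_of_isogenyClass W ℓ hCM
    (finite_isogenyClass_of_siegel W hSiegel)

/-- **Granted *AEC* Cor. IX.6.2, Satz 4 for `E` is exactly the core fact.** For a Weierstrass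
curve `W` over `K` and a prime `ℓ`, if `WeierstrassCurve.finite_isogenyClass W` holds then
`mem_span_range_tateEndRingHom_iff W ℓ` ⟺ `exists_eq_smul_one_of_equivariant_of_not_hasRationalCM W ℓ`
(forward unconditionally, `exists_eq_smul_one_of_equivariant_of_not_hasRationalCM_of_faltings`).
[cite: Faltings1983Endlichkeit, §5 Satz 4] -/
theorem mem_span_range_tateEndRingHom_iff_iff_core_of_isogenyClass (hS : W.finite_isogenyClass) :
    mem_span_range_tateEndRingHom_iff W ℓ ↔
      exists_eq_smul_one_of_equivariant_of_not_hasRationalCM W ℓ :=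
  ⟨exists_eq_smul_one_of_equivariant_of_not_hasRationalCM_of_faltings W ℓ,
    mem_span_range_tateEndRingHom_iff_of_isogenyClass_of_core W ℓ hS⟩

/-- **Granted Siegel's theorem, Satz 4 for `E` is exactly the core fact.**
[cite: Faltings1983Endlichkeit, §5 Satz 4] -/
theorem mem_span_range_tateEndRingHom_iff_iff_core_of_siegel
    (hSiegel : siegel_finite_integralPoints K) :
    mem_span_range_tateEndRingHom_iff W ℓ ↔
      exists_eq_smul_one_of_equivariant_of_not_hasRationalCM W ℓ :=
  mem_span_range_tateEndRingHom_iff_iff_core_of_isogenyClass W ℓ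
    (finite_isogenyClass_of_siegel W hSiegel)

/-! ## Satz 4 for `E` as the non-abelianness of the `ℓ`-adic image -/

/-- **A non-abelian image for every curve with `End_K(E) = ℤ` gives the core fact**: if for
`E` elliptic over a number field with no `K`-rational complex multiplication some `ρ(σ), ρ(τ)`
do not commute on `V_ℓ E`, then `exists_eq_smul_one_of_equivariant_of_not_hasRationalCM W ℓ`
(the tree's `core_of_exists_mul_ne_mul`, forgetting the irreducibility hypothesis).
[cite: Faltings1983Endlichkeit, §5 Satz 4] -/
theorem core_of_forall_exists_mul_ne_mul
    (h : ∀ [NumberField K] [W.IsElliptic], ¬ W.HasRationalCM →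
      ∃ σ τ : Field.absoluteGaloisGroup K,
        rationalGaloisRepTate W ℓ σ * rationalGaloisRepTate W ℓ τ ≠
          rationalGaloisRepTate W ℓ τ * rationalGaloisRepTate W ℓ σ) :
    exists_eq_smul_one_of_equivariant_of_not_hasRationalCM W ℓ :=
  core_of_exists_mul_ne_mul W ℓ fun hCM _ ↦ h hCM

/-- **Satz 4 for `E` from *AEC* Cor. IX.6.2 and a non-abelian `ℓ`-adic image.** If
`WeierstrassCurve.finite_isogenyClass W` holds and, whenever `E` is elliptic over a number field
with `End_K(E) = ℤ`, the image of `Γ_K` in `GL(V_ℓ E)` is not abelian (Serre 1968, Ch. IV, 2.2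
for curves without complex multiplication), then `mem_span_range_tateEndRingHom_iff W ℓ`.
[cite: Faltings1983Endlichkeit, §5 Satz 4 (proof)] -/
theorem mem_span_range_tateEndRingHom_iff_of_isogenyClass_of_exists_mul_ne_mul
    (hS : W.finite_isogenyClass)
    (h : ∀ [NumberField K] [W.IsElliptic], ¬ W.HasRationalCM →
      ∃ σ τ : Field.absoluteGaloisGroup K,
        rationalGaloisRepTate W ℓ σ * rationalGaloisRepTate W ℓ τ ≠
          rationalGaloisRepTate W ℓ τ * rationalGaloisRepTate W ℓ σ) :
    mem_span_range_tateEndRingHom_iff W ℓ :=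
  mem_span_range_tateEndRingHom_iff_of_isogenyClass_of_core W ℓ hS
    (core_of_forall_exists_mul_ne_mul W ℓ h)

/-- **Granted *AEC* Cor. IX.6.2, Satz 4 for `E` is the non-abelianness of the `ℓ`-adic image of
the curves with `End_K(E) = ℤ`.** For a Weierstrass curve `W` over `K` and a prime `ℓ`, if
`WeierstrassCurve.finite_isogenyClass W` holds then `mem_span_range_tateEndRingHom_iff W ℓ`
(Faltings' Satz 4 for `E`) is equivalent to: whenever `K` is a number field, `E = W` is elliptic
and `E` has no `K`-rational complex multiplication, there are `σ, τ ∈ Γ_K` with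
`ρ(σ) ρ(τ) ≠ ρ(τ) ρ(σ)` on `V_ℓ E` (forward unconditionally, `exists_mul_ne_mul_of_faltings`;
backward through the core fact). This is the form in which the residual is proved in print:
Serre, *Abelian ℓ-adic representations and elliptic curves* (1968), Ch. IV, 2.2 (non-CM curves:
`Lie ρ_ℓ(Γ_K) = End(V_ℓ E)`), resp. Faltings' Sätze 1–2 applied to the abelian surfaces
`(E × E)/G_n`. [cite: Faltings1983Endlichkeit, §5 Satz 4] -/
theorem mem_span_range_tateEndRingHom_iff_iff_exists_mul_ne_mul_of_isogenyClass
    (hS : W.finite_isogenyClass) :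
    mem_span_range_tateEndRingHom_iff W ℓ ↔
      ∀ [NumberField K] [W.IsElliptic], ¬ W.HasRationalCM →
        ∃ σ τ : Field.absoluteGaloisGroup K,
          rationalGaloisRepTate W ℓ σ * rationalGaloisRepTate W ℓ τ ≠
            rationalGaloisRepTate W ℓ τ * rationalGaloisRepTate W ℓ σ :=
  ⟨fun h4 _ _ hCM ↦ exists_mul_ne_mul_of_faltings W ℓ h4 hCM,
    mem_span_range_tateEndRingHom_iff_of_isogenyClass_of_exists_mul_ne_mul W ℓ hS⟩

/-- **Granted Siegel's theorem, Satz 4 for `E` is the non-abelianness of the `ℓ`-adic image of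
the curves with `End_K(E) = ℤ`.** [cite: Faltings1983Endlichkeit, §5 Satz 4] -/
theorem mem_span_range_tateEndRingHom_iff_iff_exists_mul_ne_mul_of_siegel
    (hSiegel : siegel_finite_integralPoints K) :
    mem_span_range_tateEndRingHom_iff W ℓ ↔
      ∀ [NumberField K] [W.IsElliptic], ¬ W.HasRationalCM →
        ∃ σ τ : Field.absoluteGaloisGroup K,
          rationalGaloisRepTate W ℓ σ * rationalGaloisRepTate W ℓ τ ≠
            rationalGaloisRepTate W ℓ τ * rationalGaloisRepTate W ℓ σ :=
  mem_span_range_tateEndRingHom_iff_iff_exists_mul_ne_mul_of_isogenyClass W ℓ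
    (finite_isogenyClass_of_siegel W hSiegel)

/-! ## Irreducibility of `V_ℓ E` for `End_K(E) = ℤ` from *AEC* Cor. IX.6.2 (Serre 1968, IV.2.1) -/

/-- **For `End_K(E) = ℤ`, Shafarevich's finiteness of the isogeny class makes `V_ℓ E`
irreducible** — the argument of Serre, *Abelian ℓ-adic representations* (1968), Ch. IV, 2.1
("Šafarevič's theorem ⇒ `V_ℓ` irreducible if `E` has no complex multiplication"), with complex
multiplication read over `K`: granted `WeierstrassCurve.finite_isogenyClass W` (*AEC*
Cor. IX.6.2), if `E` is elliptic over a number field `K` with no `K`-rational complex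
multiplication then `V_ℓ E` has no `Γ_K`-stable `ℚ_ℓ`-line. A stable line is `a(V_ℓ E)` for some
`a ∈ E_ℓ` (the tree's line realization `exists_mem_rationalEndSpan_eq_range_of_finite_isogenyClass`,
Tate's argument on the quotients `E/G_n`, with the quotient isogenies
`WeierstrassCurve.exists_isogeny_ker_eq_and_comp_eq_nsmul_holds`), and for `End_K(E) = ℤ` such an
`a` would be a scalar with a line as image (`finrank_ne_one_of_stable_of_not_hasRationalCM`).
In particular the irreducibility hypothesis of the core fact costs nothing granted Cor. IX.6.2.
[cite: Serre1968, Ch. IV §2.1] [cite: SilvermanAEC2009, Cor. IX.6.2] -/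
theorem finrank_ne_one_of_stable_of_not_hasRationalCM_of_isogenyClass
    (hS : W.finite_isogenyClass) [NumberField K] [W.IsElliptic] (hCM : ¬ W.HasRationalCM)
    (L : Submodule ℚ_[ℓ] (W.rationalTateModule ℓ))
    (hL : ∀ σ : Field.absoluteGaloisGroup K, ∀ v ∈ L, rationalGaloisRepTate W ℓ σ v ∈ L) :
    finrank ℚ_[ℓ] L ≠ 1 :=
  have hℓK : ((ℓ : ℕ) : K) ≠ 0 := Nat.cast_ne_zero.mpr (Fact.out : ℓ.Prime).ne_zero
  finrank_ne_one_of_stable_of_not_hasRationalCM W ℓ hℓK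
    (fun L hL hL1 ↦ exists_mem_rationalEndSpan_eq_range_of_finite_isogenyClass ℓ hℓK hS
      (fun S hS' hst ↦ exists_isogeny_ker_eq_and_comp_eq_nsmul_holds W S hS' hst) L hL hL1)
    hCM L hL

/-- **For `End_K(E) = ℤ`, Siegel's theorem makes `V_ℓ E` irreducible**: as
`finrank_ne_one_of_stable_of_not_hasRationalCM_of_isogenyClass`, with *AEC* Cor. IX.6.2 supplied
by `WeierstrassCurve.finite_isogenyClass_of_siegel`.
[cite: Serre1968, Ch. IV §2.1] [cite: SilvermanAEC2009, Cor. IX.6.2 with Cor. IX.3.2.1] -/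
theorem finrank_ne_one_of_stable_of_not_hasRationalCM_of_siegel
    (hSiegel : siegel_finite_integralPoints K) [NumberField K] [W.IsElliptic]
    (hCM : ¬ W.HasRationalCM) (L : Submodule ℚ_[ℓ] (W.rationalTateModule ℓ))
    (hL : ∀ σ : Field.absoluteGaloisGroup K, ∀ v ∈ L, rationalGaloisRepTate W ℓ σ v ∈ L) :
    finrank ℚ_[ℓ] L ≠ 1 :=
  finrank_ne_one_of_stable_of_not_hasRationalCM_of_isogenyClass W ℓ
    (finite_isogenyClass_of_siegel W hSiegel) hCM L hL

/-! ## Faltings' Korollar 1 for `(E, E)` from the same two inputs -/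

/-- **Faltings' Korollar 1 for the pair `(E, E)` from *AEC* Cor. IX.6.2 and the core fact**:
the named fact `mem_span_range_tateModule_map_of_equivariant W W ℓ` (every `Γ_K`-equivariant
`ℤ_ℓ`-linear `T_ℓ E → T_ℓ E` is a `ℤ_ℓ`-combination of the `T_ℓ φ`, `φ : E → E` an isogeny over
`K`) from `WeierstrassCurve.finite_isogenyClass W` and the core fact — the tree's
`mem_span_range_tateModule_map_of_equivariant_self_of_facts_of_core` with *AEC* Prop. III.4.12
discharged by `WeierstrassCurve.exists_separable_isogeny_ker_eq_holds`.
[cite: Faltings1983Endlichkeit, §5 Satz 4, Korollar 1] -/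
theorem mem_span_range_tateModule_map_of_equivariant_self_of_isogenyClass_of_core
    (hS : W.finite_isogenyClass)
    (hcore : exists_eq_smul_one_of_equivariant_of_not_hasRationalCM W ℓ) :
    mem_span_range_tateModule_map_of_equivariant W W ℓ := by
  -- tactic form: a term-mode proof trips the `overlappingInstances` linter on the two
  -- `[W.IsElliptic]` binders of the unfolded fact for the pair `(W, W)`
  intro _ _ _
  exact mem_span_range_tateModule_map_of_equivariant_self_of_facts_of_core W ℓ hS
    (exists_separable_isogeny_ker_eq_holds W) hcore

/-- **Faltings' Korollar 1 for the pair `(E, E)` from Siegel's theorem and the core fact.**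
[cite: Faltings1983Endlichkeit, §5 Satz 4, Korollar 1] -/
theorem mem_span_range_tateModule_map_of_equivariant_self_of_siegel_of_core
    (hSiegel : siegel_finite_integralPoints K)
    (hcore : exists_eq_smul_one_of_equivariant_of_not_hasRationalCM W ℓ) :
    mem_span_range_tateModule_map_of_equivariant W W ℓ := by
  intro _ _ _
  exact mem_span_range_tateModule_map_of_equivariant_self_of_isogenyClass_of_core W ℓ
    (finite_isogenyClass_of_siegel W hSiegel) hcore

end Literature.AlgebraicGeometry.Motives

end
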